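import Summits.QuantumFields.BalabanUV.Beta.GAN24.WilsonEdgeCurrentDiag
import Summits.QuantumFields.BalabanUV.Beta.GAN24.WilsonEdgeCurrent

/-!
# `BalabanUV.Beta.GAN24.WilsonEdgeCurrentDivFree` — binder row G-an2-4 ∕ (CONV-C), W-slot CT-W, conservation law (C)∕(C)sym AT LEVELS `j ≥ 1`: THE BASE OF THE EXIT-FACE-CURRENT
# TOWER (this lineage's gen-68 note `HOME/b2b-balaban-gan24-formalise-leaf-04/g68/EXIT-FACE-CURRENT-TOWER.md` (I6)): **THE WILSON EDGE CURRENT OF g64's `WilsonEdgeCurrent` —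
# the cubic Wilson stencil with its slot weighted by a single-coordinate profile `p(t_γ)` and its first leg by `q(y_α)` — IS DIVERGENCE-FREE IN ITS OPEN LEG, for every `p q`, every
# pair of axes (`γ ≠ α` by the closed form, `γ = α` because the current vanishes)**

NOT IN PRINT; OUR BOOKKEEPING ([folklore] finite algebra over g64's closed form `WilsonEdgeCurrent.sum_box1_biweighted_wilsonA_at` (`[b=γ]p(z_γ)(q(z_α−1)−q(z_α)) +
[b=α]q(z_α)(p(z_γ)−p(z_γ−1))`) and `WilsonEdgeCurrentDiag.sum_box1_biweighted_wilsonA_diag_at` (`0`); G-an2-4 formalisation swarm, leaf prover `b2b-balaban-gan24-formalise-leaf-04`,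
gen 68).  HONEST FRAMING (cell contract, verbatim): «discharging `BetaPertH` makes Bałaban's UV stability UNCONDITIONAL — a real constructive-QFT result; it is NOT the continuum limit
and NOT the Clay problem.»  HONEST DEPENDENCY (verbatim): «continuum YM on T⁴ ⇐ BetaPertH ∧ nine spine estimates (0/9 proved); BetaPertH ⇐ (D1) ∧ (D4) ∧ CAP+tail; G-an2-4 gates asym,
D1 and NE2/3/4.»

WHY.  Hypothesis (D) of 24_j (`VHWordsZeroLatticeStep`) — «the level-`j` exit-face current is divergence-free» (ENGINE R-leaf04-g68-1: 9.4e-16 at level 1) — descends level by level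
(the level-`(j+1)` current is the multiplier response of `G_j` to a level-`j` current with slot and leg data in the span of face profiles and lifted sawtooth gradients; an2's
`KernelWardHColumnWall.colH_ward_KInvStep_all` ∕ `KernelLegPullback` turn its coarse divergence into the fine divergence one level down) to level `0`, where all such data are
single-coordinate profiles `p(x_κ)` on `κ`-bonds and the Wilson current has g64's closed form: its divergence telescopes to
`(p(z_γ) − p(z_γ−1))(q(z_α−1) − q(z_α)) + (q(z_α) − q(z_α−1))(p(z_γ) − p(z_γ−1)) = 0`.

WHAT ([folklore]; generic `d`; 0 `def`, 0 cited facts, 0 `def … : Prop`, 0 sorry): `edgeCurrent_divFree` (the closed form's divergence is `0`, pure algebra, `γ ≠ α`),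
**`sum_wilsonA_biweighted_divFree`** (`Σ_b (J_b(z) − J_b(z − e_b)) = 0` for the stencil sums themselves, `γ ≠ α`), **`sum_wilsonA_biweighted_divFree_diag`** (`γ = α`),
**`sum_wilsonA_biweighted_divFree_all`** (every `γ α`).  Asserts NO value of Bałaban's tables beyond an3's DEFINED stencil; discharges NOTHING of (C)sym ∕ (Q-D) ∕ (Q-D-rate) ∕
«T2Shape» ∕ «T2Drift» ∕ (hW, hWall); NEVER «G-an2-4 closed» as (CONV-C); NOT D1, NOT `BetaPertH`, NOT continuum, NOT Clay.  2026-08-23; no existing file touched.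
-/

noncomputable section

open Finset
open scoped BigOperators
open Literature.MathematicalPhysics.QuantumFieldTheory
open Literature.MathematicalPhysics.QuantumFieldTheory.Balaban1983to89
open Literature.MathematicalPhysics.QuantumFieldTheory.Balaban1983to89.Beta
open StepJetData (wilsonA)
open BalabanStepJets (box1)
open AffineAveraging (unitVec)
open Summit.QuantumFields.BalabanUV.Beta.GAN24.WilsonEdgeCurrent (sum_box1_biweighted_wilsonA_at)
open Summit.QuantumFields.BalabanUV.Beta.GAN24.WilsonEdgeCurrentDiag (sum_box1_biweighted_wilsonA_diag_at)

namespace Summit.QuantumFields.BalabanUV.Beta.GAN24.WilsonEdgeCurrentDivFree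

variable {d : ℕ}

/-! ## §1 The closed form is divergence-free -/

section Closed

variable {γ α : Fin (d + 1)} (hγα : γ ≠ α)
include hγα

omit hγα in
/-- [folklore] Coordinates of `z − e_b`. -/
theorem sub_unitVec_apply (z : Fin (d + 1) → ℤ) (b κ : Fin (d + 1)) : (z - unitVec b) κ = if κ = b then z κ - 1 else z κ := by
  simp only [Pi.sub_apply, AffineAveraging.unitVec]
  split_ifs with h
  · subst h; simp
  · simp [h]

/-- [folklore] **THE EDGE CURRENT's CLOSED FORM IS DIVERGENCE-FREE** (`γ ≠ α`, all `p q`, every `z`):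
`Σ_b (J_b(z) − J_b(z − e_b)) = 0` for `J_b(z) = [b=γ]p(z_γ)(q(z_α−1)−q(z_α)) + [b=α]q(z_α)(p(z_γ)−p(z_γ−1))`. -/
theorem edgeCurrent_divFree (p q : ℤ → ℝ) (z : Fin (d + 1) → ℤ) :
    ∑ b : Fin (d + 1),
      (((if b = γ then p (z γ) * (q (z α - 1) - q (z α)) else 0) + (if b = α then q (z α) * (p (z γ) - p (z γ - 1)) else 0)) -
        ((if b = γ then p ((z - unitVec b) γ) * (q ((z - unitVec b) α - 1) - q ((z - unitVec b) α)) else 0) +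
          (if b = α then q ((z - unitVec b) α) * (p ((z - unitVec b) γ) - p ((z - unitVec b) γ - 1)) else 0))) = 0 := by
  have e : ∀ b : Fin (d + 1),
      (((if b = γ then p (z γ) * (q (z α - 1) - q (z α)) else 0) + (if b = α then q (z α) * (p (z γ) - p (z γ - 1)) else 0)) -
        ((if b = γ then p ((z - unitVec b) γ) * (q ((z - unitVec b) α - 1) - q ((z - unitVec b) α)) else 0) +
          (if b = α then q ((z - unitVec b) α) * (p ((z - unitVec b) γ) - p ((z - unitVec b) γ - 1)) else 0))) =
      (if b = γ then p (z γ) * (q (z α - 1) - q (z α)) - p (z γ - 1) * (q (z α - 1) - q (z α)) else 0) +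
        (if b = α then q (z α) * (p (z γ) - p (z γ - 1)) - q (z α - 1) * (p (z γ) - p (z γ - 1)) else 0) := by
    intro b
    by_cases hbγ : b = γ
    · subst hbγ
      simp only [if_true, if_neg hγα, sub_unitVec_apply, if_neg (Ne.symm hγα), add_zero]
    · by_cases hbα : b = α
      · subst hbα
        simp only [if_true, if_neg hbγ, sub_unitVec_apply, if_neg hγα, zero_add]
      · simp only [if_neg hbγ, if_neg hbα, add_zero, sub_self]
  rw [Finset.sum_congr rfl fun b _ => e b, Finset.sum_add_distrib, Finset.sum_ite_eq' Finset.univ γ, Finset.sum_ite_eq' Finset.univ α]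
  simp only [Finset.mem_univ, if_true]
  ring

end Closed

/-! ## §2 The stencil sums -/

section Stencil

variable {γ α : Fin (d + 1)}

/-- [folklore] **THE BIWEIGHTED WILSON CURRENT IS DIVERGENCE-FREE IN ITS OPEN LEG** (`γ ≠ α`; slot along `γ` weighted by `p(t_γ)`, first leg along `α` weighted by `q(y_α)`,
second leg `(z, b)` open): `Σ_b (J_b(z) − J_b(z − e_b)) = 0`, `J_b(z) = Σ_{x,w∈box1} p((z−w)_γ)·q((z−w+x)_α)·wilsonA d γ (z−w) (z−w+x) z (inl α)(inl b)`. -/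
theorem sum_wilsonA_biweighted_divFree (hγα : γ ≠ α) (p q : ℤ → ℝ) (z : Fin (d + 1) → ℤ) :
    ∑ b : Fin (d + 1),
      ((∑ x ∈ box1 (d + 1), ∑ w ∈ box1 (d + 1), p ((z - w) γ) * q ((z - w + x) α) * wilsonA d γ (z - w) (z - w + x) z (Sum.inl α) (Sum.inl b)) -
        ∑ x ∈ box1 (d + 1), ∑ w ∈ box1 (d + 1), p ((z - unitVec b - w) γ) * q ((z - unitVec b - w + x) α) *
          wilsonA d γ (z - unitVec b - w) (z - unitVec b - w + x) (z - unitVec b) (Sum.inl α) (Sum.inl b)) = 0 := by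
  simp only [sum_box1_biweighted_wilsonA_at hγα]
  exact edgeCurrent_divFree hγα p q z

/-- [folklore] **… AND FOR EQUAL AXES** (`γ = α`): the current itself vanishes (`WilsonEdgeCurrentDiag`). -/
theorem sum_wilsonA_biweighted_divFree_diag (p q : ℤ → ℝ) (z : Fin (d + 1) → ℤ) :
    ∑ b : Fin (d + 1),
      ((∑ x ∈ box1 (d + 1), ∑ w ∈ box1 (d + 1), p ((z - w) γ) * q ((z - w + x) γ) * wilsonA d γ (z - w) (z - w + x) z (Sum.inl γ) (Sum.inl b)) -
        ∑ x ∈ box1 (d + 1), ∑ w ∈ box1 (d + 1), p ((z - unitVec b - w) γ) * q ((z - unitVec b - w + x) γ) *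
          wilsonA d γ (z - unitVec b - w) (z - unitVec b - w + x) (z - unitVec b) (Sum.inl γ) (Sum.inl b)) = 0 := by
  simp only [sum_box1_biweighted_wilsonA_diag_at, sub_self, Finset.sum_const_zero]

/-- [folklore] **EVERY PAIR OF AXES**. -/
theorem sum_wilsonA_biweighted_divFree_all (γ α : Fin (d + 1)) (p q : ℤ → ℝ) (z : Fin (d + 1) → ℤ) :
    ∑ b : Fin (d + 1),
      ((∑ x ∈ box1 (d + 1), ∑ w ∈ box1 (d + 1), p ((z - w) γ) * q ((z - w + x) α) * wilsonA d γ (z - w) (z - w + x) z (Sum.inl α) (Sum.inl b)) -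
        ∑ x ∈ box1 (d + 1), ∑ w ∈ box1 (d + 1), p ((z - unitVec b - w) γ) * q ((z - unitVec b - w + x) α) *
          wilsonA d γ (z - unitVec b - w) (z - unitVec b - w + x) (z - unitVec b) (Sum.inl α) (Sum.inl b)) = 0 := by
  by_cases hγα : γ = α
  · subst hγα; exact sum_wilsonA_biweighted_divFree_diag p q z
  · exact sum_wilsonA_biweighted_divFree hγα p q z

end Stencil

end Summit.QuantumFields.BalabanUV.Beta.GAN24.WilsonEdgeCurrentDivFree

end
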